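import Literature.AnabelianGeometry.EtaleTheta.SettingModelChiCusp
import Literature.AnabelianGeometry.EtaleTheta.SettingModelTateCusp
import HarnessLib

/-!
# The cusp decomposition group `b^Ẑ ⋊ G_{ℚ_p}` of the χ-twisted root models is NOT normal in `Π^tp_X = Γ ⋊ G_{ℚ_p}`:
# the cusps of `Y` form a NON-TRIVIAL `Π^tp_X`-torsor (kernel certificate for the «genuine cusp torsor» label; proof-only)

Mochizuki, *The étale theta function …*, Publ. RIMS **45** (2009) [EtTh], §1, PRIMS p. 239 («any decomposition group of
a cusp of `Y^log` determines, up to conjugation by `(Δ^tp_Y)^ell`, a section …»; the cusps of `Y` are a `Z`-torsor)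
[cite: MochizukiEtTh2009, §1 p.13]; *Semi-graphs of anabelioids* [SemiAnbd], §6 p. 71 [cite: MochizukiSemiAnbd2006, §6 p.71].
abc-iut cell, seat abc-iut-w5-d111 (gen 4); R78 cluster.  PROOF-ONLY (0 definitions, 0 instances).

abc-iut-w5-d218's `OncePuncturedTemperedGroupPadicWitness` labels its cusp family honestly as DEGENERATE — «a single
normal subgroup».  At the cusped χ-models (abc-iut-w5-d029's `curveχ′`, `cuspDecompχ p = b^Ẑ ⋊ G_{ℚ_p}`; the stage-2 twin
`cuspDecompχq p i j` of `SettingModelTateCusp`) this degeneracy is GONE, and this file certifies it in the kernel: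

* **`not_mem_bAxis_conj_eta_b`** — `η(a)·η(b)·η(a)⁻¹ ∉ b^Ẑ` in `F̂₂`: map `F̂₂` continuously onto `S₃ = Perm (Fin 3)` with
  `a ↦ (0 1)`, `b ↦ (0 2)` (abc-iut-L2-t1's `exists_continuousMonoidHom_extend`); `b^Ẑ` goes into `{1, (0 2)}` (density of
  `ι(ℤ)` in `Ẑ`, discreteness of `S₃`), while `a b a⁻¹ ↦ (1 2)`;
* **`not_normal_cuspDecompχ : ¬ (cuspDecompχ p).Normal`**, `exists_conj_cuspDecompχ_ne` — conjugating by `inl(η a, 1) ∈ Π^tp_X`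
  moves `b^Ẑ ⋊ G_{ℚ_p}` off itself (its `inl(η b, 0)` goes to `inl(η(aba⁻¹), 0) ∉ b^Ẑ ⋊ G_{ℚ_p}`); hence the cusp family of
  the `OncePuncturedTemperedGroup ℚ_p`-datum of `SettingModelChiCuspTheta` (the `Π^tp_X`-conjugacy class of `b^Ẑ ⋊ G_{ℚ_p}`)
  has at least two members;
* `not_normal_cuspDecompχq`, `exists_conj_cuspDecompχq_ne` — the same at the stage-2 carrier (the computation `inl γ · inl δ ·
  (inl γ)⁻¹ = inl(γδγ⁻¹)` does not see the action).
HONEST LABEL: semi-synthetic models — consistency evidence only; classical group theory; nothing of [EtTh]/[SemiAnbd] asserted;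
no side taken on [IUTchIII] Cor. 3.12.
-/

noncomputable section

namespace Literature.AnabelianGeometry.EtaleTheta.SettingModel

open Literature.AnabelianGeometry.SemiGraphs _root_.Topology _root_.Function

/-! ### `a b a⁻¹ ∉ b^Ẑ` in `F̂₂`, via `S₃` -/

/-- **`η(a)·η(b)·η(a)⁻¹ ∉ b^Ẑ`** in `F̂₂`: under the continuous extension `F : F̂₂ → S₃` of `a ↦ (0 1)`, `b ↦ (0 2)` the closed
procyclic axis `b^Ẑ` lands in `{1, (0 2)}`, but `a b a⁻¹ ↦ (0 1)(0 2)(0 1) = (1 2)`. [cite: MochizukiEtTh2009, §1 p.13] -/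
theorem not_mem_bAxis_conj_eta_b :
    eta (FreeGroup.of 0) * eta (FreeGroup.of 1) * (eta (FreeGroup.of 0))⁻¹ ∉ bAxis := by
  classical
  -- `S₃ = Perm (Fin 3)` with the discrete topology
  letI : TopologicalSpace (Equiv.Perm (Fin 3)) := ⊥
  haveI : DiscreteTopology (Equiv.Perm (Fin 3)) := ⟨rfl⟩
  let sa : Equiv.Perm (Fin 3) := Equiv.swap 0 1
  let sb : Equiv.Perm (Fin 3) := Equiv.swap 0 2
  let f : F₂ →* Equiv.Perm (Fin 3) := FreeGroup.lift ![sa, sb]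
  have hfa : f (FreeGroup.of 0) = sa := by simp [f]
  have hfb : f (FreeGroup.of 1) = sb := by simp [f]
  obtain ⟨F, hF⟩ := exists_continuousMonoidHom_extend F₂ (Equiv.Perm (Fin 3)) f
  have hFeta : ∀ g : F₂, F (eta g) = f g := fun g => by rw [eta_apply]; exact hF g
  -- `F(b^t) ∈ {1, sb}` for every `t ∈ Ẑ`: the set of such `t` is closed and contains the dense `ι(ℤ)`
  let H : Set (Equiv.Perm (Fin 3)) := {x | x = 1 ∨ x = sb}
  have hpow : ∀ k : ℤ, sb ^ k ∈ H := by
    intro k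
    -- `sb` has order `2`
    have h2 : sb * sb = 1 := by decide
    show sb ^ k = 1 ∨ sb ^ k = sb
    rcases Int.even_or_odd k with ⟨m, rfl⟩ | ⟨m, rfl⟩
    · left
      rw [← two_mul, zpow_mul, zpow_two, h2, one_zpow]
    · right
      rw [zpow_add, zpow_mul, zpow_two, h2, one_zpow, one_mul, zpow_one]
  have hall : ∀ t : ZH, F (bPow t) ∈ H := by
    have hclosed : IsClosed ((fun t : ZH => F (bPow t)) ⁻¹' H) :=
      (isClosed_discrete H).preimage (F.continuous.comp bPow.continuous)
    have hdense : DenseRange (iotaZ : Multiplicative ℤ → ZH) :=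
      ProfiniteGrp.ProfiniteCompletion.denseRange (GrpCat.of (Multiplicative ℤ))
    have hsub : Set.range (iotaZ : Multiplicative ℤ → ZH) ⊆ (fun t : ZH => F (bPow t)) ⁻¹' H := by
      rintro _ ⟨k, rfl⟩
      show F (bPow (iotaZ k)) ∈ H
      rw [bPow_iotaZ, map_zpow, hFeta, hfb]
      exact hpow _
    have huniv : (fun t : ZH => F (bPow t)) ⁻¹' H = Set.univ := by
      apply Set.eq_univ_of_univ_subset
      rw [← hdense.closure_range]
      exact closure_minimal hsub hclosed
    intro t
    have : t ∈ (fun t : ZH => F (bPow t)) ⁻¹' H := by rw [huniv]; exact Set.mem_univ t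
    exact this
  -- but `F(a b a⁻¹) = (1 2) ∉ {1, (0 2)}`
  intro hmem
  obtain ⟨t, ht⟩ := (mem_bAxis_iff _).mp hmem
  have hval : F (eta (FreeGroup.of 0) * eta (FreeGroup.of 1) * (eta (FreeGroup.of 0))⁻¹) = sa * sb * sa⁻¹ := by
    rw [map_mul, map_mul, map_inv, hFeta, hFeta, hfa, hfb]
  have hH : F (bPow t) = 1 ∨ F (bPow t) = sb := hall t
  rw [ht, hval] at hH
  rcases hH with h | h
  · exact absurd h (by decide)
  · exact absurd h (by decide)

/-- Hence `(η a, 1)·(η b, 0)·(η a, 1)⁻¹ ∉ b^Ẑ ⊆ Γ` (read on first components). [cite: MochizukiEtTh2009, §1 p.13] -/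
theorem not_mem_bAxisGfp_conj :
    (⟨(eta (FreeGroup.of 0), expA (FreeGroup.of 0)), eta_mk_mem_Gfp _⟩ : Gfp) * bPowGfp (iotaZ (Multiplicative.ofAdd 1)) *
        (⟨(eta (FreeGroup.of 0), expA (FreeGroup.of 0)), eta_mk_mem_Gfp _⟩ : Gfp)⁻¹ ∉ bAxisGfp := by
  intro h
  obtain ⟨t, ht⟩ := (mem_bAxisGfp_iff _).mp h
  have h1 := congrArg (fun q : Gfp => (q : F₂hatT × Multiplicative ℤ).1) ht
  simp only [Subgroup.coe_mul, Subgroup.coe_inv, Prod.fst_mul, Prod.fst_inv, coe_bPowGfp, bPow_iotaZ_one] at h1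
  exact not_mem_bAxis_conj_eta_b ((mem_bAxis_iff _).mpr ⟨t, h1⟩)

/-! ### Non-normality of the cusp decomposition groups -/

variable (p : ℕ) [Fact p.Prime]

/-- **`b^Ẑ ⋊ G_{ℚ_p}` is NOT normal in `Π^tp_X = Γ ⋊_χ G_{ℚ_p}`**: conjugation by `inl(η a, 1)` takes its element
`inl(η b, 0)` outside. [cite: MochizukiEtTh2009, §1 p.13] -/
theorem not_normal_cuspDecompχ : ¬ (cuspDecompχ p).Normal := by
  intro hN
  set γ : Gfp := ⟨(eta (FreeGroup.of 0), expA (FreeGroup.of 0)), eta_mk_mem_Gfp _⟩ with hγ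
  set δ : Gfp := bPowGfp (iotaZ (Multiplicative.ofAdd 1)) with hδ
  have hmem : (SemidirectProduct.inl δ : PiTpχ p) ∈ cuspDecompχ p :=
    (mem_cuspDecompχ_iff p _).mpr (by rw [SemidirectProduct.left_inl]; exact bPowGfp_mem_bAxisGfp _)
  have hconj := hN.conj_mem _ hmem (SemidirectProduct.inl γ)
  rw [← map_inv, ← map_mul, ← map_mul, mem_cuspDecompχ_iff, SemidirectProduct.left_inl] at hconj
  exact not_mem_bAxisGfp_conj hconj

/-- **The cusps of `Y` form a non-trivial torsor at the χ-model**: some `Π^tp_X`-conjugate of the cusp decomposition group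
differs from it — the cusp family of the `OncePuncturedTemperedGroup ℚ_p`-datum of `SettingModelChiCuspTheta` (the conjugacy
class of `b^Ẑ ⋊ G_{ℚ_p}`) has at least two members. [cite: MochizukiEtTh2009, §1 p.13] -/
theorem exists_conj_cuspDecompχ_ne :
    ∃ g : PiTpχ p, (cuspDecompχ p).map (MulAut.conj g).toMonoidHom ≠ cuspDecompχ p := by
  by_contra h
  simp only [not_exists, ne_eq, not_not] at h
  exact not_normal_cuspDecompχ p ⟨fun d hd g => by
    have := h g ▸ Subgroup.mem_map_of_mem (MulAut.conj g).toMonoidHom hd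
    simpa using this⟩

variable (i j : ℤ)

/-- **Stage 2: `b^Ẑ ⋊ G_{ℚ_p}` is NOT normal in `Γ ⋊_{actχq} G_{ℚ_p}`** (same witness; the conjugation
`inl γ · inl δ · (inl γ)⁻¹ = inl(γδγ⁻¹)` does not see the action). [cite: MochizukiEtTh2009, §1 p.13] -/
theorem not_normal_cuspDecompχq : ¬ (cuspDecompχq p i j).Normal := by
  intro hN
  set γ : Gfp := ⟨(eta (FreeGroup.of 0), expA (FreeGroup.of 0)), eta_mk_mem_Gfp _⟩ with hγ
  set δ : Gfp := bPowGfp (iotaZ (Multiplicative.ofAdd 1)) with hδ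
  have hmem : (SemidirectProduct.inl δ : PiTpχq p i j) ∈ cuspDecompχq p i j :=
    (mem_cuspDecompχq_iff p i j _).mpr (by rw [SemidirectProduct.left_inl]; exact bPowGfp_mem_bAxisGfp _)
  have hconj := hN.conj_mem _ hmem (SemidirectProduct.inl γ)
  rw [← map_inv, ← map_mul, ← map_mul, mem_cuspDecompχq_iff, SemidirectProduct.left_inl] at hconj
  exact not_mem_bAxisGfp_conj hconj

/-- The cusps form a non-trivial torsor at the stage-2 model as well. [cite: MochizukiEtTh2009, §1 p.13] -/
theorem exists_conj_cuspDecompχq_ne :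
    ∃ g : PiTpχq p i j, (cuspDecompχq p i j).map (MulAut.conj g).toMonoidHom ≠ cuspDecompχq p i j := by
  by_contra h
  simp only [not_exists, ne_eq, not_not] at h
  exact not_normal_cuspDecompχq p i j ⟨fun d hd g => by
    have := h g ▸ Subgroup.mem_map_of_mem (MulAut.conj g).toMonoidHom hd
    simpa using this⟩

end Literature.AnabelianGeometry.EtaleTheta.SettingModel

end
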